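import Summits.ValiantsHypothesis.ValiantsHypothesis.Theorems.KPlusLogSqLawDiagonalDesign
import Summits.ValiantsHypothesis.ValiantsHypothesis.Theorems.KPlusLogSqLawTropicalBPadding
import Summits.ValiantsHypothesis.ValiantsHypothesis.Theorems.KPlusLogSqLawTropicalShiftThreeChain
import Summits.ValiantsHypothesis.ValiantsHypothesis.Theorems.LacunarySymmetroidMatrixDescartesLowRankSector

/-!
# Route «KPlusLogSqLaw» — `Lifting` VERBATIM by RANK PROFILE: pencils with at most THREE letters of large rank
# (toward crux `Lifting`, stmt-ValiantsHypothesis-19772; helper, seat val-sym-lift-p2)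

HONEST FRAMING.  Object-search cell `pub-symmetroid`, Conjecture-B route `KPlusLogSqLaw`.  The crux `Lifting` (OPEN, not claimed):
«a tropical row bound `n` at format `(m, K)` gives the real row bound `2^{CK}·(n+1)`».  This file proves its inequality VERBATIM, for
ALL formats and ALL supports, on the pencils whose RANK PROFILE has at most three large letters — and records why FOUR large
letters is exactly the route's `K = 4` fork:

* the tree's size-free monomial count `lowRankCeiling` (val-sym-mdr-p2: `Z₊ + 1 ≤ ∏_{l ≠ l₀} (rank Sₗ + 1)`, one pivot `l₀` of
  arbitrary rank) absorbs FURTHER letters of arbitrary rank at the price `rank + 1 ≤ m + 1` each; so with `t` letters of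
  arbitrary rank and all others of rank `< 2^c` the real count is `Z < 2·(m+1)^{t−1}·2^{c(K−t)}` — degree `t − 1` in `m`;
* the TROPICAL FLOOR of matching degree pays for it: `t = 2` needs the linear floor `m(K−1) ≤ n` (tree `DiagK.le_of_tropRootLawAt`),
  `t = 3` needs the QUADRATIC floor `C(m+2,2) − 2 ≤ n` for `K ≥ 3` (val-sym-lift-p3's SHIFT-THREE family,
  `choose_sub_two_le_of_tropRootLawAt_three`, padded to `K` classes by trop-p1's `tropRootLawAt_of_le_classes`);
* `t = 4` would need a CUBIC tropical floor `T(m,K) ≥ c·m³` for `K ≥ 4` — the open design half of the `K = 4` fork (D2: is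
  `T(m,4)` cubic or quadratic?).  So: **a failure of `Lifting` with constant `C ≥ 1` needs at least FOUR letters of rank `≥ 2^C`,
  and with exactly four it needs `T(m,4) = o(m³)`-type behaviour of the tropical census.**

Results (no symmetry of the letters needed; `c ≥ 1`): `lifting_twoFreeLetters` (`Z ≤ 2^{cK}(n+1)` if all letters but two have
rank `< 2^c`), `lifting_threeFreeLetters` (same with three), with the sharp real counts `card_roots_twoFree_le`
(`Z ≤ 2(m+1)·2^{c(K−2)} − 1`) and `card_roots_threeFree_le` (`Z ≤ 2(m+1)²·2^{c(K−3)} − 1`) and the quadratic floor in `K`-class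
form `choose_sub_two_le_of_tropRootLawAt` (`3 ≤ K → TropRootLawAt m K n → C(m+2,2) − 2 ≤ n`).  On these sectors Conjecture B is
known too (the real count is polynomial in `m` times `2^{cK}`), so this is a HELPER map of where `Lifting` cannot fail (desk R1348),
complementing `…LiftingSupportSectors` (one free letter; height; affine supports), `…LiftingPencilSectors` (commuting, span-two) and
`…LiftingDescartesZone` (cones `m ≤ cK`).  Nothing here bears on `TropicalB`, `KPlusLogSqLaw` in its window, `MatrixDescartes`
(stmt-ValiantsHypothesis-18050), a Door-A numeral, or `VP ≠ VNP`. [folklore]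
-/

-- `Summit.ValiantsHypothesis.ValiantsHypothesis.…` repeats a component by the D-0017 layout
-- (single-conjunct summit), which the `dupNamespace` linter flags; the name is mandated.
set_option linter.dupNamespace false
set_option autoImplicit false

namespace Summit.ValiantsHypothesis.ValiantsHypothesis.Theorems.LacunarySymmetroidMatrixDescartes.TropicalCensus

open Summit.ValiantsHypothesis.ValiantsHypothesis.Theorems.LacunarySymmetroidMatrixDescartes
open scoped BigOperators
open Polynomial

namespace RankProfile

/-- splitting one more free letter `l₁ ≠ l₀` off the low-rank product: `∏_{l ≠ l₀} (rank Sₗ + 1) ≤ (m+1)·∏_{l ≠ l₀, l₁} (rank Sₗ + 1)`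
(`rank S_{l₁} ≤ m`). [folklore] -/
theorem prod_erase_le_succ_mul {K m : ℕ} (l₀ l₁ : Fin K) (h01 : l₁ ≠ l₀) (S : Fin K → Matrix (Fin m) (Fin m) ℝ) :
    ∏ l ∈ Finset.univ.erase l₀, ((S l).rank + 1)
      ≤ (m + 1) * ∏ l ∈ (Finset.univ.erase l₀).erase l₁, ((S l).rank + 1) := by
  rw [← Finset.mul_prod_erase (Finset.univ.erase l₀) (fun l => (S l).rank + 1)
    (Finset.mem_erase.mpr ⟨h01, Finset.mem_univ _⟩)]
  exact Nat.mul_le_mul_right _ (Nat.succ_le_succ (Matrix.rank_le_width (S l₁)))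

/-- a product of factors `≤ 2^c` over a set of `j` letters is `≤ (2^c)^j`. [folklore] -/
theorem prod_le_pow_of_lt {K m : ℕ} (c : ℕ) (T : Finset (Fin K)) (S : Fin K → Matrix (Fin m) (Fin m) ℝ)
    (hr : ∀ l ∈ T, (S l).rank < 2 ^ c) : ∏ l ∈ T, ((S l).rank + 1) ≤ (2 ^ c) ^ T.card :=
  Finset.prod_le_pow_card _ _ _ fun l hl => Nat.succ_le_of_lt (hr l hl)

/-- **two free letters, positive zeros**: `Z₊ + 1 ≤ (m+1)·(2^c)^(K−2)` when every letter outside `{l₀, l₁}` has rank `< 2^c`. [folklore] -/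
theorem card_posRoots_succ_le_two {K m : ℕ} (c : ℕ) (l₀ l₁ : Fin K) (h01 : l₁ ≠ l₀) (d : Fin K → ℕ)
    (S : Fin K → Matrix (Fin m) (Fin m) ℝ) (hr : ∀ l, l ≠ l₀ → l ≠ l₁ → (S l).rank < 2 ^ c) :
    ((Matrix.det (∑ l, ((X : ℝ[X]) ^ d l) • (S l).map C)).roots.toFinset.filter (fun t => 0 < t)).card + 1
      ≤ (m + 1) * (2 ^ c) ^ (K - 2) := by
  refine (lowRankCeiling l₀ d S).trans ((prod_erase_le_succ_mul l₀ l₁ h01 S).trans (Nat.mul_le_mul_left _ ?_))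
  have hcard : ((Finset.univ.erase l₀).erase l₁).card = K - 2 := by
    rw [Finset.card_erase_of_mem (Finset.mem_erase.mpr ⟨h01, Finset.mem_univ _⟩),
      Finset.card_erase_of_mem (Finset.mem_univ _), Finset.card_univ, Fintype.card_fin]
    omega
  rw [← hcard]
  exact prod_le_pow_of_lt c _ S fun l hl =>
    hr l (Finset.ne_of_mem_erase (Finset.mem_of_mem_erase hl)) (Finset.ne_of_mem_erase hl)

/-- **three free letters, positive zeros**: `Z₊ + 1 ≤ (m+1)²·(2^c)^(K−3)` when every letter outside `{l₀, l₁, l₂}` has rank `< 2^c`.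
[folklore] -/
theorem card_posRoots_succ_le_three {K m : ℕ} (c : ℕ) (l₀ l₁ l₂ : Fin K) (h01 : l₁ ≠ l₀) (h02 : l₂ ≠ l₀) (h12 : l₂ ≠ l₁)
    (d : Fin K → ℕ) (S : Fin K → Matrix (Fin m) (Fin m) ℝ)
    (hr : ∀ l, l ≠ l₀ → l ≠ l₁ → l ≠ l₂ → (S l).rank < 2 ^ c) :
    ((Matrix.det (∑ l, ((X : ℝ[X]) ^ d l) • (S l).map C)).roots.toFinset.filter (fun t => 0 < t)).card + 1
      ≤ (m + 1) ^ 2 * (2 ^ c) ^ (K - 3) := by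
  refine (lowRankCeiling l₀ d S).trans ((prod_erase_le_succ_mul l₀ l₁ h01 S).trans ?_)
  have hmem2 : l₂ ∈ (Finset.univ.erase l₀).erase l₁ :=
    Finset.mem_erase.mpr ⟨h12, Finset.mem_erase.mpr ⟨h02, Finset.mem_univ _⟩⟩
  have hsplit := Finset.mul_prod_erase ((Finset.univ.erase l₀).erase l₁) (fun l => (S l).rank + 1) hmem2
  have hcard : (((Finset.univ.erase l₀).erase l₁).erase l₂).card = K - 3 := by
    rw [Finset.card_erase_of_mem hmem2, Finset.card_erase_of_mem (Finset.mem_erase.mpr ⟨h01, Finset.mem_univ _⟩),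
      Finset.card_erase_of_mem (Finset.mem_univ _), Finset.card_univ, Fintype.card_fin]
    omega
  have hrest : ∏ l ∈ ((Finset.univ.erase l₀).erase l₁).erase l₂, ((S l).rank + 1) ≤ (2 ^ c) ^ (K - 3) := by
    rw [← hcard]
    exact prod_le_pow_of_lt c _ S fun l hl =>
      hr l (Finset.ne_of_mem_erase (Finset.mem_of_mem_erase (Finset.mem_of_mem_erase hl)))
        (Finset.ne_of_mem_erase (Finset.mem_of_mem_erase hl)) (Finset.ne_of_mem_erase hl)
  have h2 : (S l₂).rank + 1 ≤ m + 1 := Nat.succ_le_succ (Matrix.rank_le_width (S l₂))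
  rw [← hsplit, pow_two, mul_assoc]
  exact Nat.mul_le_mul_left _ (Nat.mul_le_mul h2 hrest)

end RankProfile

/-- **THE QUADRATIC TROPICAL FLOOR in `K`-class form**: for `K ≥ 3`, `TropRootLawAt m K n → C(m+2,2) − 2 ≤ n` (SHIFT-THREE,
`choose_sub_two_le_of_tropRootLawAt_three`, padded by `tropRootLawAt_of_le_classes`). [folklore] -/
theorem choose_sub_two_le_of_tropRootLawAt {m K n : ℕ} (hK : 3 ≤ K) (hT : TropRootLawAt m K n) :
    (m + 2).choose 2 - 2 ≤ n :=
  choose_sub_two_le_of_tropRootLawAt_three m n (KPlusLogSqLaw.tropRootLawAt_of_le_classes hK hT)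

/-- **TWO FREE LETTERS, all real zeros**: if every letter outside `{l₀, l₁}` has rank `< 2^c`, then
`Z ≤ 2(m+1)·(2^c)^(K−2) − 1` for every support (the pencil and its reflection, plus the origin: `stub_negRoots`). [folklore] -/
theorem card_roots_twoFree_le {K m : ℕ} (c : ℕ) (l₀ l₁ : Fin K) (h01 : l₁ ≠ l₀) (d : Fin K → ℕ)
    (S : Fin K → Matrix (Fin m) (Fin m) ℝ) (hr : ∀ l, l ≠ l₀ → l ≠ l₁ → (S l).rank < 2 ^ c) :
    (Matrix.det (∑ l, ((X : ℝ[X]) ^ d l) • (S l).map C)).roots.toFinset.card ≤ 2 * ((m + 1) * (2 ^ c) ^ (K - 2)) - 1 := by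
  have hr' : ∀ l, l ≠ l₀ → l ≠ l₁ → (((-1 : ℝ) ^ d l) • S l).rank < 2 ^ c := fun l h0 h1 =>
    lt_of_le_of_lt (Literature.Computability.AlgebraicComplexity.rank_smul_le _ _) (hr l h0 h1)
  have hA := RankProfile.card_posRoots_succ_le_two c l₀ l₁ h01 d S hr
  have hB := RankProfile.card_posRoots_succ_le_two c l₀ l₁ h01 d (fun l => ((-1 : ℝ) ^ d l) • S l) hr'
  have hZ := stub_negRoots K m d S
  omega

/-- **`Lifting` verbatim with TWO FREE LETTERS** (constant `c ≥ 1`, every format, every support, no symmetry): if all letters but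
`l₀, l₁` have rank `< 2^c`, a tropical row bound `n` at `(m, K)` gives `Z ≤ 2^{cK}·(n+1)` — the linear real count
`2(m+1)·2^{c(K−2)}` against the linear tropical floor `m(K−1) ≤ n`. [folklore] -/
theorem lifting_twoFreeLetters {K m : ℕ} (c n : ℕ) (hc : 1 ≤ c) (hT : TropRootLawAt m K n) (l₀ l₁ : Fin K) (h01 : l₁ ≠ l₀)
    (d : Fin K → ℕ) (S : Fin K → Matrix (Fin m) (Fin m) ℝ) (hr : ∀ l, l ≠ l₀ → l ≠ l₁ → (S l).rank < 2 ^ c) :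
    (Matrix.det (∑ l, ((X : ℝ[X]) ^ d l) • (S l).map C)).roots.toFinset.card ≤ 2 ^ (c * K) * (n + 1) := by
  have hZ := card_roots_twoFree_le c l₀ l₁ h01 d S hr
  have hK : 2 ≤ K := by
    have h0 := l₀.isLt; have h1 := l₁.isLt
    by_contra hlt
    have : (l₁ : ℕ) = (l₀ : ℕ) := by omega
    exact h01 (Fin.ext this)
  have hfloor : m ≤ n := by
    have h := DiagK.le_of_tropRootLawAt m K hK hT
    calc m = m * 1 := (Nat.mul_one m).symm
      _ ≤ m * (K - 1) := Nat.mul_le_mul_left m (by omega)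
      _ ≤ n := h
  obtain ⟨K', rfl⟩ : ∃ K', K = K' + 2 := ⟨K - 2, by omega⟩
  rw [Nat.add_sub_cancel] at hZ
  set P : ℕ := (2 ^ c) ^ K' with hP
  have h2c : 2 ≤ 2 ^ c := by
    calc (2 : ℕ) = 2 ^ 1 := by norm_num
      _ ≤ 2 ^ c := Nat.pow_le_pow_right (by norm_num) hc
  have hpow : 2 ^ (c * (K' + 2)) = P * (2 ^ c * 2 ^ c) := by
    rw [hP]; ring
  have h4 : 2 * P ≤ P * (2 ^ c * 2 ^ c) := by
    have := Nat.mul_le_mul_left P (Nat.mul_le_mul h2c h2c)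
    linarith
  calc (Matrix.det (∑ l, ((X : ℝ[X]) ^ d l) • (S l).map C)).roots.toFinset.card
      ≤ 2 * ((m + 1) * P) - 1 := hZ
    _ ≤ 2 * P * (m + 1) := by rw [mul_comm (m + 1) P, ← mul_assoc]; exact Nat.sub_le _ _
    _ ≤ P * (2 ^ c * 2 ^ c) * (n + 1) := Nat.mul_le_mul h4 (Nat.succ_le_succ hfloor)
    _ = 2 ^ (c * (K' + 2)) * (n + 1) := by rw [hpow]

/-- **THREE FREE LETTERS, all real zeros**: if every letter outside `{l₀, l₁, l₂}` has rank `< 2^c`, then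
`Z ≤ 2(m+1)²·(2^c)^(K−3) − 1` for every support. [folklore] -/
theorem card_roots_threeFree_le {K m : ℕ} (c : ℕ) (l₀ l₁ l₂ : Fin K) (h01 : l₁ ≠ l₀) (h02 : l₂ ≠ l₀) (h12 : l₂ ≠ l₁)
    (d : Fin K → ℕ) (S : Fin K → Matrix (Fin m) (Fin m) ℝ)
    (hr : ∀ l, l ≠ l₀ → l ≠ l₁ → l ≠ l₂ → (S l).rank < 2 ^ c) :
    (Matrix.det (∑ l, ((X : ℝ[X]) ^ d l) • (S l).map C)).roots.toFinset.card
      ≤ 2 * ((m + 1) ^ 2 * (2 ^ c) ^ (K - 3)) - 1 := by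
  have hr' : ∀ l, l ≠ l₀ → l ≠ l₁ → l ≠ l₂ → (((-1 : ℝ) ^ d l) • S l).rank < 2 ^ c := fun l h0 h1 h2 =>
    lt_of_le_of_lt (Literature.Computability.AlgebraicComplexity.rank_smul_le _ _) (hr l h0 h1 h2)
  have hA := RankProfile.card_posRoots_succ_le_three c l₀ l₁ l₂ h01 h02 h12 d S hr
  have hB := RankProfile.card_posRoots_succ_le_three c l₀ l₁ l₂ h01 h02 h12 d (fun l => ((-1 : ℝ) ^ d l) • S l) hr'
  have hZ := stub_negRoots K m d S
  omega

/-- the arithmetic of the three-free-letter rung: `2(m+1)²·P ≤ P·(2^c)³·(n+1)` from the quadratic floor `C(m+2,2) − 2 ≤ n` and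
`c ≥ 1`. [folklore] -/
theorem threeFree_arith (c m n P : ℕ) (hc : 1 ≤ c) (hfloor : (m + 2).choose 2 - 2 ≤ n) :
    2 * ((m + 1) ^ 2 * P) ≤ P * (2 ^ c * 2 ^ c * 2 ^ c) * (n + 1) := by
  have h2c : 2 ≤ 2 ^ c := by
    calc (2 : ℕ) = 2 ^ 1 := by norm_num
      _ ≤ 2 ^ c := Nat.pow_le_pow_right (by norm_num) hc
  have h8 : 8 ≤ 2 ^ c * 2 ^ c * 2 ^ c := by
    calc (8 : ℕ) = 2 * 2 * 2 := by norm_num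
      _ ≤ 2 ^ c * 2 ^ c * 2 ^ c := Nat.mul_le_mul (Nat.mul_le_mul h2c h2c) h2c
  -- `2·C(m+2,2) = (m+2)(m+1)`
  have hchoose : (m + 2) * (m + 1) = (m + 2).choose 2 * 2 := by
    have h := Nat.add_one_mul_choose_eq (m + 1) 1
    rw [Nat.choose_one_right] at h
    exact h
  -- `8·(n+1) ≥ 2·(m+1)²`
  have hkey : 2 * (m + 1) ^ 2 ≤ 8 * (n + 1) := by
    have h1 : (m + 2).choose 2 ≤ n + 2 := by omega
    nlinarith
  calc 2 * ((m + 1) ^ 2 * P) = (2 * (m + 1) ^ 2) * P := by ring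
    _ ≤ (8 * (n + 1)) * P := Nat.mul_le_mul_right P hkey
    _ ≤ ((2 ^ c * 2 ^ c * 2 ^ c) * (n + 1)) * P := Nat.mul_le_mul_right P (Nat.mul_le_mul_right _ h8)
    _ = P * (2 ^ c * 2 ^ c * 2 ^ c) * (n + 1) := by ring

/-- **`Lifting` verbatim with THREE FREE LETTERS** (constant `c ≥ 1`, every format, every support, no symmetry): if all letters
but `l₀, l₁, l₂` have rank `< 2^c`, a tropical row bound `n` at `(m, K)` gives `Z ≤ 2^{cK}·(n+1)` — the quadratic real count
`2(m+1)²·2^{c(K−3)}` against the QUADRATIC tropical floor `C(m+2,2) − 2 ≤ n` of SHIFT-THREE (three distinct letters force `K ≥ 3`).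
FOUR free letters would need a cubic floor at `K ≥ 4`: the route's open `K = 4` fork. [folklore] -/
theorem lifting_threeFreeLetters {K m : ℕ} (c n : ℕ) (hc : 1 ≤ c) (hT : TropRootLawAt m K n) (l₀ l₁ l₂ : Fin K)
    (h01 : l₁ ≠ l₀) (h02 : l₂ ≠ l₀) (h12 : l₂ ≠ l₁) (d : Fin K → ℕ) (S : Fin K → Matrix (Fin m) (Fin m) ℝ)
    (hr : ∀ l, l ≠ l₀ → l ≠ l₁ → l ≠ l₂ → (S l).rank < 2 ^ c) :
    (Matrix.det (∑ l, ((X : ℝ[X]) ^ d l) • (S l).map C)).roots.toFinset.card ≤ 2 ^ (c * K) * (n + 1) := by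
  have hZ := card_roots_threeFree_le c l₀ l₁ l₂ h01 h02 h12 d S hr
  have hK : 3 ≤ K := by
    have h0 := l₀.isLt; have h1 := l₁.isLt; have h2 := l₂.isLt
    by_contra hlt
    have hK2 : K ≤ 2 := by omega
    have e01 : (l₁ : ℕ) ≠ (l₀ : ℕ) := fun h => h01 (Fin.ext h)
    have e02 : (l₂ : ℕ) ≠ (l₀ : ℕ) := fun h => h02 (Fin.ext h)
    have e12 : (l₂ : ℕ) ≠ (l₁ : ℕ) := fun h => h12 (Fin.ext h)
    omega
  have hfloor := choose_sub_two_le_of_tropRootLawAt hK hT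
  obtain ⟨K', rfl⟩ : ∃ K', K = K' + 3 := ⟨K - 3, by omega⟩
  rw [Nat.add_sub_cancel] at hZ
  set P : ℕ := (2 ^ c) ^ K' with hP
  have hpow : 2 ^ (c * (K' + 3)) = P * (2 ^ c * 2 ^ c * 2 ^ c) := by
    rw [hP]; ring
  have harith := threeFree_arith c m n P hc hfloor
  calc (Matrix.det (∑ l, ((X : ℝ[X]) ^ d l) • (S l).map C)).roots.toFinset.card
      ≤ 2 * ((m + 1) ^ 2 * P) - 1 := hZ
    _ ≤ 2 * ((m + 1) ^ 2 * P) := Nat.sub_le _ _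
    _ ≤ P * (2 ^ c * 2 ^ c * 2 ^ c) * (n + 1) := harith
    _ = 2 ^ (c * (K' + 3)) * (n + 1) := by rw [hpow]


/-! ### The general rung: `t` free letters against a tropical floor of degree `t − 1` (appended 2026-08-26, same seat)

The two rungs above are the cases `t = 2, 3` of one statement: with `t` letters of arbitrary rank (a finset `T`, `|T| = t ≥ 1`)
and all other letters of rank `< 2^c`, the real count is `Z ≤ 2(m+1)^{t−1}·2^{c(K−t)} − 1`, so `Lifting`'s inequality with constant
`c` holds as soon as the tropical row supplies the DEGREE-`(t−1)` FLOOR `2(m+1)^{t−1} ≤ 2^{ct}·(n+1)`.  For `t = 4` this floor is a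
CUBIC lower bound on the tropical census at `K ≥ 4` — the open design half of the route's `K = 4` fork (kernel data of record:
`T(3,4) = 19 = C(6,3) − 1`, val-sym-lift-p1 g2, `…TropicalCensusThreeFour`); the rung `lifting_freeLetters_of_floor` is stated with the
floor as a HYPOTHESIS and asserts nothing about it. -/

namespace RankProfile

/-- splitting the low-rank product along a finset `T ∋ l₀` of free letters:
`∏_{l ≠ l₀} (rank Sₗ + 1) ≤ (m+1)^{|T|−1} · (2^c)^{K−|T|}` when every letter outside `T` has rank `< 2^c`. [folklore] -/
theorem prod_erase_le_free {K m : ℕ} (c : ℕ) (T : Finset (Fin K)) (l₀ : Fin K) (hl₀ : l₀ ∈ T)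
    (S : Fin K → Matrix (Fin m) (Fin m) ℝ) (hr : ∀ l, l ∉ T → (S l).rank < 2 ^ c) :
    ∏ l ∈ Finset.univ.erase l₀, ((S l).rank + 1) ≤ (m + 1) ^ (T.card - 1) * (2 ^ c) ^ (K - T.card) := by
  classical
  have hsplit : Finset.univ.erase l₀ = (T.erase l₀) ∪ (Finset.univ \ T) := by
    ext l
    simp only [Finset.mem_erase, Finset.mem_univ, and_true, Finset.mem_union, Finset.mem_sdiff, true_and]
    constructor
    · intro hl
      by_cases hT : l ∈ T
      · exact Or.inl ⟨hl, hT⟩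
      · exact Or.inr hT
    · rintro (⟨hl, -⟩ | hl)
      · exact hl
      · intro h; exact hl (h ▸ hl₀)
  have hdisj : Disjoint (T.erase l₀) (Finset.univ \ T) :=
    Finset.disjoint_left.mpr fun l hl hl' => (Finset.mem_sdiff.mp hl').2 (Finset.mem_of_mem_erase hl)
  rw [hsplit, Finset.prod_union hdisj]
  have h1 : ∏ l ∈ T.erase l₀, ((S l).rank + 1) ≤ (m + 1) ^ (T.card - 1) := by
    rw [← Finset.card_erase_of_mem hl₀]
    exact Finset.prod_le_pow_card _ _ _ fun l _ => Nat.succ_le_succ (Matrix.rank_le_width (S l))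
  have h2 : ∏ l ∈ Finset.univ \ T, ((S l).rank + 1) ≤ (2 ^ c) ^ (K - T.card) := by
    have hcard : (Finset.univ \ T).card = K - T.card := by
      rw [Finset.card_sdiff_of_subset (Finset.subset_univ T), Finset.card_univ, Fintype.card_fin]
    rw [← hcard]
    exact prod_le_pow_of_lt c _ S fun l hl => hr l (Finset.mem_sdiff.mp hl).2
  exact Nat.mul_le_mul h1 h2

/-- **`t` free letters, positive zeros**: `Z₊ + 1 ≤ (m+1)^{|T|−1}·(2^c)^{K−|T|}` when every letter outside the finset `T` (nonempty) has
rank `< 2^c`. [folklore] -/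
theorem card_posRoots_succ_le_free {K m : ℕ} (c : ℕ) (T : Finset (Fin K)) (l₀ : Fin K) (hl₀ : l₀ ∈ T) (d : Fin K → ℕ)
    (S : Fin K → Matrix (Fin m) (Fin m) ℝ) (hr : ∀ l, l ∉ T → (S l).rank < 2 ^ c) :
    ((Matrix.det (∑ l, ((X : ℝ[X]) ^ d l) • (S l).map C)).roots.toFinset.filter (fun t => 0 < t)).card + 1
      ≤ (m + 1) ^ (T.card - 1) * (2 ^ c) ^ (K - T.card) :=
  (lowRankCeiling l₀ d S).trans (prod_erase_le_free c T l₀ hl₀ S hr)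

end RankProfile

/-- **`t` FREE LETTERS, all real zeros**: if every letter outside a nonempty finset `T` has rank `< 2^c`, then
`Z ≤ 2(m+1)^{|T|−1}·(2^c)^{K−|T|} − 1` for every support (pencil + reflection + origin). [folklore] -/
theorem card_roots_free_le {K m : ℕ} (c : ℕ) (T : Finset (Fin K)) (hT : T.Nonempty) (d : Fin K → ℕ)
    (S : Fin K → Matrix (Fin m) (Fin m) ℝ) (hr : ∀ l, l ∉ T → (S l).rank < 2 ^ c) :
    (Matrix.det (∑ l, ((X : ℝ[X]) ^ d l) • (S l).map C)).roots.toFinset.card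
      ≤ 2 * ((m + 1) ^ (T.card - 1) * (2 ^ c) ^ (K - T.card)) - 1 := by
  obtain ⟨l₀, hl₀⟩ := hT
  have hr' : ∀ l, l ∉ T → (((-1 : ℝ) ^ d l) • S l).rank < 2 ^ c := fun l hl =>
    lt_of_le_of_lt (Literature.Computability.AlgebraicComplexity.rank_smul_le _ _) (hr l hl)
  have hA := RankProfile.card_posRoots_succ_le_free c T l₀ hl₀ d S hr
  have hB := RankProfile.card_posRoots_succ_le_free c T l₀ hl₀ d (fun l => ((-1 : ℝ) ^ d l) • S l) hr'
  have hZ := stub_negRoots K m d S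
  omega

/-- **THE GENERAL RUNG — `Lifting` verbatim with `t` free letters, GIVEN a tropical floor of degree `t − 1`.**  If every letter
outside a nonempty finset `T` (`|T| = t`) has rank `< 2^c`, and the tropical row bound `n` at `(m, K)` satisfies the floor
`2(m+1)^{t−1} ≤ (2^c)^t·(n+1)`, then `Z ≤ 2^{cK}·(n+1)`.  The floor is a THEOREM for `t = 2` (`m(K−1) ≤ n`, linear) and `t = 3`
(`C(m+2,2) − 2 ≤ n`, SHIFT-THREE) — see `lifting_twoFreeLetters` / `lifting_threeFreeLetters` — and for `t = 4` it is a CUBIC tropical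
lower bound at `K ≥ 4`, the open design half of the `K = 4` fork: nothing is claimed about it here. [folklore] -/
theorem lifting_freeLetters_of_floor {K m : ℕ} (c n : ℕ) (T : Finset (Fin K)) (hT : T.Nonempty)
    (hfloor : 2 * (m + 1) ^ (T.card - 1) ≤ (2 ^ c) ^ T.card * (n + 1)) (d : Fin K → ℕ)
    (S : Fin K → Matrix (Fin m) (Fin m) ℝ) (hr : ∀ l, l ∉ T → (S l).rank < 2 ^ c) :
    (Matrix.det (∑ l, ((X : ℝ[X]) ^ d l) • (S l).map C)).roots.toFinset.card ≤ 2 ^ (c * K) * (n + 1) := by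
  have hZ := card_roots_free_le c T hT d S hr
  have htK : T.card ≤ K := by
    have := Finset.card_le_univ T; rwa [Fintype.card_fin] at this
  set P : ℕ := (2 ^ c) ^ (K - T.card) with hP
  have hpow : 2 ^ (c * K) = (2 ^ c) ^ T.card * P := by
    rw [hP, ← pow_add, Nat.add_sub_cancel' htK, pow_mul]
  calc (Matrix.det (∑ l, ((X : ℝ[X]) ^ d l) • (S l).map C)).roots.toFinset.card
      ≤ 2 * ((m + 1) ^ (T.card - 1) * P) - 1 := hZ
    _ ≤ 2 * (m + 1) ^ (T.card - 1) * P := by rw [← mul_assoc]; exact Nat.sub_le _ _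
    _ ≤ (2 ^ c) ^ T.card * (n + 1) * P := Nat.mul_le_mul_right P hfloor
    _ = 2 ^ (c * K) * (n + 1) := by rw [hpow]; ring

/-- **Four free letters modulo a cubic floor** (the `K = 4` fork in rank-profile form): if, at the format `(m, K)`, the tropical row
bound `n` satisfies the CUBIC floor `2(m+1)³ ≤ 2^{4c}(n+1)` (e.g. a counting-tight-up-to-`2^{4c−1}/… ` tropical family at `K ≥ 4`),
then every pencil with at most four letters of rank `≥ 2^c` satisfies `Z ≤ 2^{cK}(n+1)`.  Conditional; the floor is NOT claimed.
[folklore] -/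
theorem lifting_fourFreeLetters_of_cubicFloor {K m : ℕ} (c n : ℕ) (l₀ l₁ l₂ l₃ : Fin K)
    (hfloor : 2 * (m + 1) ^ 3 ≤ (2 ^ c) ^ 4 * (n + 1)) (hdist : ({l₀, l₁, l₂, l₃} : Finset (Fin K)).card = 4)
    (d : Fin K → ℕ) (S : Fin K → Matrix (Fin m) (Fin m) ℝ)
    (hr : ∀ l, l ∉ ({l₀, l₁, l₂, l₃} : Finset (Fin K)) → (S l).rank < 2 ^ c) :
    (Matrix.det (∑ l, ((X : ℝ[X]) ^ d l) • (S l).map C)).roots.toFinset.card ≤ 2 ^ (c * K) * (n + 1) :=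
  lifting_freeLetters_of_floor c n {l₀, l₁, l₂, l₃} ⟨l₀, by simp⟩ (by rw [hdist]; exact hfloor) d S hr

end Summit.ValiantsHypothesis.ValiantsHypothesis.Theorems.LacunarySymmetroidMatrixDescartes.TropicalCensus
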